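import Mathlib.Analysis.Calculus.ParametricIntegral
import Mathlib.Analysis.Calculus.Deriv.MeanValue
import Mathlib.MeasureTheory.Integral.Bochner.Set
import Mathlib.MeasureTheory.Measure.Haar.InnerProductSpace
import Mathlib.MeasureTheory.Measure.Lebesgue.EqHaar
import Literature.Analysis.FluidPDE.WholeSpaceIBP
import Literature.Analysis.FluidPDE.HyperbolicConeEnergyWeight
import HarnessLib

/-!
# The energy method on truncated cones (local uniqueness for symmetric hyperbolic systems)

The analytic core of the domain-of-dependence theorem for symmetric hyperbolic systems
[Racke2015, Ch. 3 Thm 3.1 and the Remark after Cor. 3.2 ("finite propagation speed")],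
[John1982, Ch. 5 §3], [Rendall2008, §8.3 (8.28), Defs. 8.1–8.2], in a form that is
independent of the system: an **energy density** `e(t, x) ≥ 0` and **fluxes** `f₁, …, f_d` on
`[τ, τ'] × ℝᵈ` such that

* (bulk) `∂ₜe + Σⱼ ∂ⱼfⱼ ≤ M e` on `(τ, τ') × B̄(x₁, ρ)` — for a `C¹` solution `u` of a symmetric
  hyperbolic system `A⁰∂ₜu + ΣAʲ∂ⱼu + Bu = 0` with `e = ⟨u, A⁰u⟩`, `fⱼ = ⟨u, Aʲu⟩` this is
  Racke's identity `∂ₜ⟨A⁰u,u⟩ + Σ∂ⱼ⟨Aʲu,u⟩ = ⟨(∂ₜA⁰ + Σ∂ⱼAʲ - 2B)u, u⟩` [Racke2015, proof of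
  Thm 3.1, (3.9)] with `M` the bound of `H = ∂ₜA⁰ + Σ∂ⱼAʲ - 2B` relative to `A⁰`;
* (cone condition) `|Σⱼ νⱼ fⱼ| ≤ c e` for `‖ν‖ ≤ 1` on `[τ, τ'] × B̄(x₁, ρ)` — the lateral
  boundary of a cone of slope `c` is space-like, [Racke2015, (3.11)] (`|Σ(∂ⱼγ)⟨Aʲu,u⟩| ≤
  ⟨A⁰u,u⟩`), [Rendall2008, §8.3: "`A⁰ξ₀ + Aⁱξᵢ` positive definite"];
* `e(τ, ·) = 0` on the base ball `B̄(x₁, ρ)`,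

vanishes on the open solid truncated cone `dist(x, x₁) < ρ - c (t - τ)`, `τ < t ≤ τ'`
(`coneEnergy_eq_zero`). The sources integrate the identity over the cone with the divergence
theorem; here (Mathlib has no divergence theorem on cones) the identity is integrated over
`ℝᵈ` against the smooth weight `W` of `HyperbolicConeEnergyWeight.lean`, whose support shrinks
with speed `c`: `Φ(t) = ∫ W e dx` satisfies `Φ' = ∫ ∂ₜ(We) ≤ -Σⱼ ∫ ∂ⱼ(W fⱼ) = 0`
(`fderiv_coneWeight_mul_add_sum_le`, `integral_fderiv_apply_eq_zero`), `Φ(τ) = 0`, so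
`Φ ≡ 0` and `e = 0` where `W > 0`. Regularity asked of `e, fⱼ`: continuous on the closed slab,
`C¹` on the open slab, `De` bounded on `(τ, τ') × B̄(x₁, ρ)` — exactly what a `C¹` solution on
`[0, T] × ℝᵈ` provides.

## References

* [Racke2015] R. Racke, *Lectures on Nonlinear Evolution Equations. Initial Value Problems*,
  2nd ed. (2015), Ch. 3, §3.1, Thm 3.1 with proof ((3.7)–(3.11)) and the Remark after Cor. 3.2.
* [John1982] F. John, *Partial Differential Equations*, 4th ed. (1982), Ch. 5 §3.
* [Rendall2008] A. D. Rendall, *Partial Differential Equations in General Relativity* (2008),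
  §8.3, pp. 142–146: (8.28), local uniqueness, Defs. 8.1–8.2, finite speed of propagation.
-/

noncomputable section

open Set Filter MeasureTheory Metric
open scoped Topology InnerProductSpace

namespace Literature.Analysis.FluidPDE

variable {d : ℕ}

/-! ### Slices of functions on `ℝ × ℝᵈ` -/

section Slices

variable {G : Type*}

/-- A function continuous on `S ×ˢ univ` has continuous slices `x ↦ F (t, x)`, `t ∈ S`.
[folklore] -/
theorem continuous_slab_slice [TopologicalSpace G]
    {F : ℝ × EuclideanSpace ℝ (Fin d) → G} {S : Set ℝ}
    (hF : ContinuousOn F (S ×ˢ univ)) {t : ℝ} (ht : t ∈ S) : Continuous fun x => F (t, x) :=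
  hF.comp_continuous (continuous_const.prodMk continuous_id) fun x => mk_mem_prod ht (mem_univ x)

/-- A function continuous on `S ×ˢ univ` has time lines `t ↦ F (t, x)` continuous on `S`.
[folklore] -/
theorem continuousOn_slab_line [TopologicalSpace G]
    {F : ℝ × EuclideanSpace ℝ (Fin d) → G} {S : Set ℝ}
    (hF : ContinuousOn F (S ×ˢ univ)) (x : EuclideanSpace ℝ (Fin d)) :
    ContinuousOn (fun t => F (t, x)) S :=
  hF.comp (continuous_id.prodMk continuous_const).continuousOn fun _ ht => mk_mem_prod ht (mem_univ x)

/-- The spatial slice of a `C¹` function on an open slab is `C¹`, and its derivative in the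
direction `v` is the derivative of the function in the direction `(0, v)`. [folklore] -/
theorem fderiv_slab_slice_apply [NormedAddCommGroup G] [NormedSpace ℝ G]
    {F : ℝ × EuclideanSpace ℝ (Fin d) → G} {q : ℝ × EuclideanSpace ℝ (Fin d)}
    (hF : DifferentiableAt ℝ F q) (v : EuclideanSpace ℝ (Fin d)) :
    fderiv ℝ (fun x => F (q.1, x)) q.2 v = fderiv ℝ F q (0, v) := by
  have h := (hF.hasFDerivAt.comp q.2 (hasFDerivAt_prodMk_right (𝕜 := ℝ) q.1 q.2)).fderiv
  rw [show (fun x => F (q.1, x)) = F ∘ fun x => (q.1, x) from rfl, h]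
  simp

end Slices

/-! ### The cone lemma -/

/-- **The energy method on a truncated cone** ([Racke2015, Thm 3.1]; [John1982, Ch. 5 §3];
[Rendall2008, §8.3 (8.28)]), abstract form. Let `e, f₁, …, f_d : ℝ × ℝᵈ → ℝ` be continuous on
`[τ, τ'] × ℝᵈ` and `C¹` on `(τ, τ') × ℝᵈ`, with `‖De‖ ≤ C` on `(τ, τ') × B̄(x₁, ρ)`, `e ≥ 0` on
`[τ, τ'] × B̄(x₁, ρ)`, the bulk inequality `∂ₜe + Σⱼ∂ⱼfⱼ ≤ M e` on `(τ, τ') × B̄(x₁, ρ)`, the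
cone condition `|Σⱼ νⱼfⱼ| ≤ c e` (`‖ν‖ ≤ 1`, `c ≥ 0`) on `[τ, τ'] × B̄(x₁, ρ)`, and
`e(τ, ·) = 0` on `B̄(x₁, ρ)`. Then `e(t, x) = 0` whenever `τ < t ≤ τ'` and
`dist(x, x₁) < ρ - c (t - τ)`: the energy vanishes in the solid backward cone of slope `c` over
the base ball ("the solution `u` at time `t` only depends on values of the initial datum in
`K₀`" [Racke2015, Remark after Cor. 3.2]). [cite: Racke2015, Ch. 3 Thm 3.1] -/
theorem coneEnergy_eq_zero {τ τ' ρ c M C : ℝ} {x₁ : EuclideanSpace ℝ (Fin d)}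
    {e : ℝ × EuclideanSpace ℝ (Fin d) → ℝ} {f : Fin d → ℝ × EuclideanSpace ℝ (Fin d) → ℝ}
    (hc : 0 ≤ c) (he_cont : ContinuousOn e (Icc τ τ' ×ˢ univ))
    (he_diff : ContDiffOn ℝ 1 e (Ioo τ τ' ×ˢ univ))
    (hf_diff : ∀ j, ContDiffOn ℝ 1 (f j) (Ioo τ τ' ×ˢ univ))
    (he_bound : ∀ p ∈ Ioo τ τ' ×ˢ closedBall x₁ ρ, ‖fderiv ℝ e p‖ ≤ C)
    (he_nonneg : ∀ p ∈ Icc τ τ' ×ˢ closedBall x₁ ρ, 0 ≤ e p)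
    (hbulk : ∀ p ∈ Ioo τ τ' ×ˢ closedBall x₁ ρ,
      fderiv ℝ e p (1, 0) + ∑ j, fderiv ℝ (f j) p (0, EuclideanSpace.single j 1) ≤ M * e p)
    (hflux : ∀ p ∈ Icc τ τ' ×ˢ closedBall x₁ ρ, ∀ ν : EuclideanSpace ℝ (Fin d), ‖ν‖ ≤ 1 →
      |∑ j, ν j * f j p| ≤ c * e p)
    (hinit : ∀ x ∈ closedBall x₁ ρ, e (τ, x) = 0)
    {t : ℝ} (ht : t ∈ Ioc τ τ') {x : EuclideanSpace ℝ (Fin d)} (hx : dist x x₁ < ρ - c * (t - τ)) :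
    e (t, x) = 0 := by
  obtain ⟨hτt, htτ'⟩ := ht
  have hρ : 0 < ρ := by
    have := mul_nonneg hc (sub_nonneg.2 hτt.le)
    linarith [dist_nonneg (x := x) (y := x₁)]
  -- the margin `η`
  obtain ⟨η, hη, hηρ⟩ : ∃ η : ℝ, 0 < η ∧ dist x x₁ + 2 * η + c * (t - τ) < ρ :=
    ⟨(ρ - c * (t - τ) - dist x x₁) / 4, by linarith, by linarith⟩
  set W : ℝ × EuclideanSpace ℝ (Fin d) → ℝ := coneWeight x η c t M with hW
  have hWc : ContDiff ℝ 1 W := contDiff_coneWeight hη.ne'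
  have hWd : Differentiable ℝ W := differentiable_coneWeight hη.ne'
  -- the vanishing set of the weight
  set O : Set (ℝ × EuclideanSpace ℝ (Fin d)) :=
    {q | dist x x₁ + 2 * η + c * (t - q.1) < dist q.2 x₁} with hO
  have hO_open : IsOpen O :=
    isOpen_lt (by fun_prop) (continuous_snd.dist continuous_const)
  have hWO : ∀ q ∈ O, W q = 0 := by
    intro q hq
    by_contra hne
    have h1 := norm_sub_lt_of_coneWeight_ne_zero hη hne
    rw [← dist_eq_norm] at h1
    have h2 : dist q.2 x₁ ≤ dist q.2 x + dist x x₁ := dist_triangle _ _ _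
    simp only [hO, mem_setOf_eq] at hq
    linarith
  -- outside the closed ball and after time `τ`, we are in `O`
  have hmemO : ∀ q : ℝ × EuclideanSpace ℝ (Fin d), τ ≤ q.1 → q.2 ∉ closedBall x₁ ρ → q ∈ O := by
    intro q hq1 hq2
    rw [mem_closedBall, not_le] at hq2
    simp only [hO, mem_setOf_eq]
    nlinarith [mul_le_mul_of_nonneg_left hq1 hc]
  have hW_zero : ∀ q : ℝ × EuclideanSpace ℝ (Fin d), τ ≤ q.1 → q.2 ∉ closedBall x₁ ρ → W q = 0 :=
    fun q hq1 hq2 => hWO q (hmemO q hq1 hq2)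
  -- derivatives of `W * h` vanish on `O`
  have hfderivO : ∀ (h : ℝ × EuclideanSpace ℝ (Fin d) → ℝ) (q : ℝ × EuclideanSpace ℝ (Fin d)),
      q ∈ O → fderiv ℝ (fun p => W p * h p) q = 0 := by
    intro h q hq
    have hev : (fun p => W p * h p) =ᶠ[𝓝 q] fun _ => 0 :=
      Filter.eventually_of_mem (hO_open.mem_nhds hq) fun p hp => by simp [hWO p hp]
    rw [hev.fderiv_eq, fderiv_const_apply]
  -- the open slab and differentiability there
  set U : Set (ℝ × EuclideanSpace ℝ (Fin d)) := Ioo τ τ' ×ˢ univ with hU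
  have hU_open : IsOpen U := isOpen_Ioo.prod isOpen_univ
  have he_dAt : ∀ q ∈ U, DifferentiableAt ℝ e q := fun q hq =>
    (he_diff.differentiableOn one_ne_zero q hq).differentiableAt (hU_open.mem_nhds hq)
  have hf_dAt : ∀ j, ∀ q ∈ U, DifferentiableAt ℝ (f j) q := fun j q hq =>
    ((hf_diff j).differentiableOn one_ne_zero q hq).differentiableAt (hU_open.mem_nhds hq)
  have hWe_diff : ContDiffOn ℝ 1 (fun p => W p * e p) U := hWc.contDiffOn.mul he_diff
  have hWf_diff : ∀ j, ContDiffOn ℝ 1 (fun p => W p * f j p) U := fun j =>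
    hWc.contDiffOn.mul (hf_diff j)
  -- the compact region and bounds on it
  set K : Set (ℝ × EuclideanSpace ℝ (Fin d)) := Icc τ t ×ˢ closedBall x₁ ρ with hK
  have hK_cpt : IsCompact K := isCompact_Icc.prod (isCompact_closedBall x₁ ρ)
  have hK_sub : K ⊆ Icc τ τ' ×ˢ univ :=
    prod_mono (Icc_subset_Icc le_rfl htτ') (subset_univ _)
  obtain ⟨Be, hBe⟩ := hK_cpt.exists_bound_of_continuousOn (he_cont.mono hK_sub)
  obtain ⟨BW, hBW⟩ := hK_cpt.exists_bound_of_continuousOn hWc.continuous.continuousOn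
  obtain ⟨BW', hBW'⟩ :=
    hK_cpt.exists_bound_of_continuousOn (hWc.continuous_fderiv one_ne_zero).continuousOn
  have hBe0 : 0 ≤ Be := (norm_nonneg _).trans (hBe (τ, x₁) (mk_mem_prod ⟨le_rfl, hτt.le⟩
    (mem_closedBall_self hρ.le)))
  have hBW0 : 0 ≤ BW := (norm_nonneg _).trans (hBW (τ, x₁) (mk_mem_prod ⟨le_rfl, hτt.le⟩
    (mem_closedBall_self hρ.le)))
  -- the integrand, its time derivative, and the weighted energy
  set F : ℝ → EuclideanSpace ℝ (Fin d) → ℝ := fun s y => W (s, y) * e (s, y) with hF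
  set F' : ℝ → EuclideanSpace ℝ (Fin d) → ℝ :=
    fun s y => fderiv ℝ (fun p => W p * e p) (s, y) (1, 0) with hF'
  -- `F s` is continuous and supported in the closed ball for `s ∈ [τ, t]`
  have hF_cont : ∀ s ∈ Icc τ t, Continuous (F s) := by
    intro s hs
    exact (hWc.continuous.comp (continuous_const.prodMk continuous_id)).mul
      (continuous_slab_slice he_cont ⟨hs.1, hs.2.trans htτ'⟩)
  have hF_zero : ∀ s ∈ Icc τ t, ∀ y ∉ closedBall x₁ ρ, F s y = 0 := by
    intro s hs y hy
    simp [hF, hW_zero (s, y) hs.1 hy]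
  have hF_supp : ∀ s ∈ Icc τ t, HasCompactSupport (F s) := fun s hs =>
    HasCompactSupport.intro (isCompact_closedBall x₁ ρ) (hF_zero s hs)
  have hF_int : ∀ s ∈ Icc τ t, Integrable (F s) := fun s hs =>
    (hF_cont s hs).integrable_of_hasCompactSupport (hF_supp s hs)
  have hF_bound : ∀ s ∈ Icc τ t, ∀ y, ‖F s y‖ ≤ (closedBall x₁ ρ).indicator (fun _ => BW * Be) y := by
    intro s hs y
    by_cases hy : y ∈ closedBall x₁ ρ
    · rw [indicator_of_mem hy, hF, norm_mul]
      have hq : ((s, y) : ℝ × EuclideanSpace ℝ (Fin d)) ∈ K := mk_mem_prod hs hy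
      exact mul_le_mul (hBW _ hq) (hBe _ hq) (norm_nonneg _) hBW0
    · rw [indicator_of_notMem hy, hF_zero s hs y hy, norm_zero]
  have hbound_int : Integrable ((closedBall x₁ ρ).indicator fun _ : EuclideanSpace ℝ (Fin d) =>
      BW * Be) := (integrableOn_const measure_closedBall_lt_top.ne).integrable_indicator
        measurableSet_closedBall
  set Φ : ℝ → ℝ := fun s => ∫ y, F s y with hΦ
  -- continuity of `Φ` on `[τ, t]`
  have hΦ_cont : ContinuousOn Φ (Icc τ t) := by
    refine continuousOn_of_dominated (fun s hs => (hF_cont s hs).aestronglyMeasurable)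
      (fun s hs => Eventually.of_forall (hF_bound s hs)) hbound_int (Eventually.of_forall ?_)
    intro y
    exact ((hWc.continuous.comp (continuous_id.prodMk continuous_const)).continuousOn).mul
      ((continuousOn_slab_line he_cont y).mono (Icc_subset_Icc le_rfl htτ'))
  -- differentiability of `Φ` on `(τ, t)` with `Φ' s = ∫ F' s`
  have hF'_bound : ∀ s ∈ Ioo τ t, ∀ y,
      ‖F' s y‖ ≤ (closedBall x₁ ρ).indicator (fun _ => BW * C + Be * BW') y := by
    intro s hs y
    by_cases hy : y ∈ closedBall x₁ ρ
    · rw [indicator_of_mem hy, hF']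
      have hqU : ((s, y) : ℝ × EuclideanSpace ℝ (Fin d)) ∈ U :=
        mk_mem_prod ⟨hs.1, hs.2.trans_le htτ'⟩ (mem_univ y)
      have hqK : ((s, y) : ℝ × EuclideanSpace ℝ (Fin d)) ∈ K :=
        mk_mem_prod ⟨hs.1.le, hs.2.le⟩ hy
      have hq' : ((s, y) : ℝ × EuclideanSpace ℝ (Fin d)) ∈ Ioo τ τ' ×ˢ closedBall x₁ ρ :=
        mk_mem_prod ⟨hs.1, hs.2.trans_le htτ'⟩ hy
      simp only
      rw [fderiv_fun_mul (hWd _) (he_dAt _ hqU)]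
      simp only [add_apply, smul_apply, smul_eq_mul]
      have hv : ‖((1 : ℝ), (0 : EuclideanSpace ℝ (Fin d)))‖ ≤ 1 := by simp [Prod.norm_def]
      have h1 : ‖fderiv ℝ e (s, y) (1, 0)‖ ≤ C := by
        simpa using (fderiv ℝ e (s, y)).le_of_opNorm_le_of_le (he_bound _ hq') hv
      have h2 : ‖fderiv ℝ W (s, y) (1, 0)‖ ≤ BW' := by
        simpa using (fderiv ℝ W (s, y)).le_of_opNorm_le_of_le (hBW' _ hqK) hv
      calc ‖W (s, y) * fderiv ℝ e (s, y) (1, 0) + e (s, y) * fderiv ℝ W (s, y) (1, 0)‖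
          ≤ ‖W (s, y)‖ * ‖fderiv ℝ e (s, y) (1, 0)‖ + ‖e (s, y)‖ * ‖fderiv ℝ W (s, y) (1, 0)‖ := by
            refine (norm_add_le _ _).trans ?_
            rw [norm_mul, norm_mul]
        _ ≤ BW * C + Be * BW' :=
            add_le_add (mul_le_mul (hBW _ hqK) h1 (norm_nonneg _) hBW0)
              (mul_le_mul (hBe _ hqK) h2 (norm_nonneg _) hBe0)
    · rw [indicator_of_notMem hy]
      simp only [hF']
      rw [hfderivO e (s, y) (hmemO (s, y) hs.1.le hy)]
      simp
  have hbound'_int : Integrable ((closedBall x₁ ρ).indicator fun _ : EuclideanSpace ℝ (Fin d) =>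
      BW * C + Be * BW') := (integrableOn_const measure_closedBall_lt_top.ne).integrable_indicator
        measurableSet_closedBall
  have hWe_fderiv_cont : ContinuousOn (fderiv ℝ fun p => W p * e p) U :=
    hWe_diff.continuousOn_fderiv_of_isOpen hU_open le_rfl
  have hF'_cont : ∀ s ∈ Ioo τ t, Continuous (F' s) := by
    intro s hs
    have h1 : Continuous fun y : EuclideanSpace ℝ (Fin d) => fderiv ℝ (fun p => W p * e p) (s, y) :=
      hWe_fderiv_cont.comp_continuous (continuous_const.prodMk continuous_id) fun y =>
        mk_mem_prod ⟨hs.1, hs.2.trans_le htτ'⟩ (mem_univ y)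
    exact h1.clm_apply continuous_const
  have hΦ_deriv : ∀ s ∈ Ioo τ t, HasDerivAt Φ (∫ y, F' s y) s := by
    intro s hs
    have hsI : Ioo τ t ∈ 𝓝 s := Ioo_mem_nhds hs.1 hs.2
    refine (hasDerivAt_integral_of_dominated_loc_of_deriv_le hsI ?_ (hF_int s ⟨hs.1.le, hs.2.le⟩)
      (hF'_cont s hs).aestronglyMeasurable ?_ hbound'_int ?_).2
    · filter_upwards [hsI] with s' hs'
      exact (hF_cont s' ⟨hs'.1.le, hs'.2.le⟩).aestronglyMeasurable
    · exact Eventually.of_forall fun y s' hs' => hF'_bound s' hs' y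
    · refine Eventually.of_forall fun y s' hs' => ?_
      have hqU : ((s', y) : ℝ × EuclideanSpace ℝ (Fin d)) ∈ U :=
        mk_mem_prod ⟨hs'.1, hs'.2.trans_le htτ'⟩ (mem_univ y)
      have hd : DifferentiableAt ℝ (fun p => W p * e p) (s', y) := (hWd _).mul (he_dAt _ hqU)
      exact hd.hasFDerivAt.comp_hasDerivAt s' ((hasDerivAt_id s').prodMk (hasDerivAt_const s' y))
  -- the derivative is nonpositive
  have hΦ'_nonpos : ∀ s ∈ Ioo τ t, ∫ y, F' s y ≤ 0 := by
    intro s hs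
    have hsτ' : s < τ' := hs.2.trans_le htτ'
    -- the flux terms
    set Gj : Fin d → EuclideanSpace ℝ (Fin d) → ℝ := fun j y =>
      fderiv ℝ (fun p => W p * f j p) (s, y) (0, EuclideanSpace.single j 1) with hGj
    have hslice : ∀ j, ContDiff ℝ 1 fun y : EuclideanSpace ℝ (Fin d) => W (s, y) * f j (s, y) :=
      fun j => (hWf_diff j).comp_contDiff (contDiff_const.prodMk contDiff_id) fun y =>
        mk_mem_prod ⟨hs.1, hsτ'⟩ (mem_univ y)
    have hslice_supp : ∀ j, HasCompactSupport fun y : EuclideanSpace ℝ (Fin d) =>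
        W (s, y) * f j (s, y) := fun j =>
      HasCompactSupport.intro (isCompact_closedBall x₁ ρ) fun y hy => by
        simp [hW_zero (s, y) hs.1.le hy]
    have hGj_eq : ∀ j y, Gj j y = fderiv ℝ (fun y : EuclideanSpace ℝ (Fin d) =>
        W (s, y) * f j (s, y)) y (EuclideanSpace.single j 1) := by
      intro j y
      have hqU : ((s, y) : ℝ × EuclideanSpace ℝ (Fin d)) ∈ U :=
        mk_mem_prod ⟨hs.1, hsτ'⟩ (mem_univ y)
      have hd : DifferentiableAt ℝ (fun p => W p * f j p) (s, y) :=
        (hWd _).mul (hf_dAt j _ hqU)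
      exact (fderiv_slab_slice_apply hd _).symm
    have hGj_int0 : ∀ j, ∫ y, Gj j y = 0 := by
      intro j
      simp_rw [hGj_eq j]
      exact integral_fderiv_apply_eq_zero (hslice j) (hslice_supp j) _
    have hGj_cont : ∀ j, Continuous (Gj j) := by
      intro j
      have hcj : Continuous fun y : EuclideanSpace ℝ (Fin d) => fderiv ℝ
          (fun y : EuclideanSpace ℝ (Fin d) => W (s, y) * f j (s, y)) y
          (EuclideanSpace.single j 1) :=
        ((hslice j).continuous_fderiv one_ne_zero).clm_apply continuous_const
      exact hcj.congr fun y => (hGj_eq j y).symm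
    have hGj_supp : ∀ j, HasCompactSupport (Gj j) := fun j =>
      HasCompactSupport.intro (isCompact_closedBall x₁ ρ) fun y hy => by
        simp only [hGj]
        rw [hfderivO (f j) (s, y) (hmemO (s, y) hs.1.le hy)]
        simp
    have hGj_int : ∀ j, Integrable (Gj j) := fun j =>
      (hGj_cont j).integrable_of_hasCompactSupport (hGj_supp j)
    -- pointwise inequality
    have hpt : ∀ y, F' s y ≤ -∑ j, Gj j y := by
      intro y
      by_cases hy : y ∈ closedBall x₁ ρ
      · have hqU : ((s, y) : ℝ × EuclideanSpace ℝ (Fin d)) ∈ U :=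
          mk_mem_prod ⟨hs.1, hsτ'⟩ (mem_univ y)
        have hq' : ((s, y) : ℝ × EuclideanSpace ℝ (Fin d)) ∈ Ioo τ τ' ×ˢ closedBall x₁ ρ :=
          mk_mem_prod ⟨hs.1, hsτ'⟩ hy
        have hq'' : ((s, y) : ℝ × EuclideanSpace ℝ (Fin d)) ∈ Icc τ τ' ×ˢ closedBall x₁ ρ :=
          mk_mem_prod ⟨hs.1.le, hsτ'.le⟩ hy
        have key := fderiv_coneWeight_mul_add_sum_le (x₂ := x) (t₂ := t) (M := M) hη
          (he_dAt _ hqU) (fun j => hf_dAt j _ hqU) (hbulk _ hq') (hflux _ hq'')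
        simp only [hF', hGj]
        linarith
      · have hO' := hmemO (s, y) hs.1.le hy
        simp only [hF', hGj, hfderivO e (s, y) hO', fun j => hfderivO (f j) (s, y) hO']
        simp
    have hF'_int : Integrable (F' s) :=
      (hF'_cont s hs).integrable_of_hasCompactSupport
        (HasCompactSupport.intro (isCompact_closedBall x₁ ρ) fun y hy => by
          simp only [hF']
          rw [hfderivO e (s, y) (hmemO (s, y) hs.1.le hy)]
          simp)
    calc ∫ y, F' s y ≤ ∫ y, -∑ j, Gj j y :=
          integral_mono hF'_int (integrable_finsetSum _ fun j _ => hGj_int j).neg hpt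
      _ = 0 := by
          rw [integral_neg, integral_finsetSum _ fun j _ => hGj_int j]
          simp [hGj_int0]
  -- `Φ` is non-increasing on `[τ, t]`, `Φ τ = 0`, hence `Φ t ≤ 0`
  have hΦ_anti : AntitoneOn Φ (Icc τ t) := by
    refine antitoneOn_of_deriv_nonpos (convex_Icc τ t) hΦ_cont ?_ ?_
    · rw [interior_Icc]
      exact fun s hs => (hΦ_deriv s hs).differentiableAt.differentiableWithinAt
    · rw [interior_Icc]
      intro s hs
      rw [(hΦ_deriv s hs).deriv]
      exact hΦ'_nonpos s hs
  have hΦτ : Φ τ = 0 := by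
    simp only [hΦ]
    refine integral_eq_zero_of_ae (Eventually.of_forall fun y => ?_)
    by_cases hy : y ∈ closedBall x₁ ρ
    · simp [hF, hinit y hy]
    · exact hF_zero τ ⟨le_rfl, hτt.le⟩ y hy
  have hΦt_le : Φ t ≤ 0 := hΦτ ▸ hΦ_anti ⟨le_rfl, hτt.le⟩ ⟨hτt.le, le_rfl⟩ hτt.le
  -- but `F t ≥ 0`, so `F t = 0`, and `W (t, x) > 0`
  have hFt_nonneg : ∀ y, 0 ≤ F t y := by
    intro y
    by_cases hy : y ∈ closedBall x₁ ρ
    · exact mul_nonneg (coneWeight_nonneg _) (he_nonneg _ (mk_mem_prod ⟨hτt.le, htτ'⟩ hy))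
    · exact (hF_zero t ⟨hτt.le, le_rfl⟩ y hy).symm.le
  have hΦt : Φ t = 0 := le_antisymm hΦt_le (integral_nonneg hFt_nonneg)
  have hFt_ae : F t =ᵐ[volume] 0 :=
    (integral_eq_zero_iff_of_nonneg hFt_nonneg (hF_int t ⟨hτt.le, le_rfl⟩)).1 hΦt
  have hFt_zero : F t = 0 :=
    (Continuous.ae_eq_iff_eq (μ := volume) (hF_cont t ⟨hτt.le, le_rfl⟩) continuous_const).1 hFt_ae
  have hFtx : F t x = 0 := by rw [hFt_zero]; rfl
  have hWtx : W (t, x) = Real.exp (-(M * t)) := coneWeight_vertex hη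
  have : W (t, x) * e (t, x) = 0 := hFtx
  rw [hWtx] at this
  exact (mul_eq_zero.1 this).resolve_left (Real.exp_pos _).ne'

end Literature.Analysis.FluidPDE
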